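import Mathlib
import Summits.Schanuel.Schanuel.Theorems.SoloInformedDenisTransfer

/-!
# The Stokes-constant ladder at the emblematic point: its top rung implies `e ⟂ π`

Soloist seat `solo-Schanuel-informed`, session 7 (atlas §2 E14 / door (L), "arithmetic Gevrey
series and Stokes constants").

With `Ein(z) = ∫₀ᶻ (1 − e^{−t}) dt/t` (an `E`-function) and `E₁(z) = ∫_z^∞ e^{−t} dt/t`
(`= e^{−z} · Э(1/z)`, `Э` the Euler–Gompertz arithmetic Gevrey series of order `1`), the classical
identity `γ + log z = Ein(z) − E₁(z)` taken at the two ALGEBRAIC points `z = 1` and `z = i` gives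

  `i π / 2 = (Ein(i) − E₁(i)) − (Ein(1) − E₁(1))`,

i.e. `π` lies in the ring generated over `ℚ(i)` by `E`-values and twisted `Э`-values at algebraic
points [Fischler–Rivoal, J. Number Theory 261 (2024), arXiv:2301.13518, p. 3 and Thm 5; the `log 2`
version is their eq. for `γ + log z`]. Siegel–Shidlovskii gives the bottom rung unconditionally
(`e, e^{i}, Ein(1), Ein(i)` algebraically independent; cf. Rivoal, Michigan Math. J. 61 (2012)
Thm 2 and §7 for the one-point case); the TOP rung — algebraic independence of the six numbers
`e, e^{i}, Ein(1), Ein(i), E₁(1), E₁(i)` — is open (it contains the transcendence of Gompertz's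
constant `δ = e·E₁(1)` and of `γ = Ein(1) − E₁(1)`).

This file records, kernel-checked and with the analytic identity as an explicit HYPOTHESIS on
abstract numbers `a = Ein(1)`, `b = Ein(i)`, `d = E₁(1)`, `d' = E₁(i)`, the algebraic skeleton of
the ladder:

* `algebraicIndependent_pair_affine` — from an algebraically independent family `v`, any pair
  `(v i, c · (v j + k))` with `i ≠ j`, `k` a polynomial in the coordinates other than `j` and `c`
  a non-zero algebraic number is algebraically independent;
* `pi_pairs_of_stokesRung` — the top rung makes BOTH `(π, e)` and `(π, e^{i})` algebraically
  independent pairs (both alternatives of the Denis dichotomy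
  `algebraicIndependent_pi_exp_one_or_pi_exp_I`), and `expOnePi_of_stokesRung` — hence the tree's
  open conjecture `ExpOnePiAlgebraicIndependent` (`e ⟂ π`).

The rung is strictly stronger than `e ⟂ π`; the point of the record is WHERE `π` sits in it: at
algebraic arguments, as a Stokes constant between the base points `1` and `i`.

References: [FischlerRivoal2024] arXiv:2301.13518 (Conj. 1–3, Thm 4–5, p. 3, p. 7);
[Rivoal2012] doi:10.1307/mmj/1339011525 (Thm 2, Cor. 1–2, §7); [Andre2000] Ann. of Math. 151.
-/

noncomputable section

open Complex
open Literature.NumberTheory.Transcendental (ExpOnePiAlgebraicIndependent)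

namespace Summit.Schanuel.Schanuel.Theorems

/-! ### Affine extraction of an independent pair -/

/-- **Affine pair extraction.** Let `v : ι → ℂ` be algebraically independent over `ℚ`, `i ≠ j`,
`k ∈ ℚ[v_t : t ≠ j]` and `c ≠ 0` algebraic. Then `(v i, c · (v j + k))` is an algebraically
independent pair. [folklore] -/
theorem algebraicIndependent_pair_affine {ι : Type*} {v : ι → ℂ}
    (hv : AlgebraicIndependent ℚ v) {i j : ι} (hij : i ≠ j) {k c : ℂ}
    (hk : k ∈ Algebra.adjoin ℚ (v '' ({j}ᶜ : Set ι))) (hc : IsAlgebraic ℚ c) (hc0 : c ≠ 0) :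
    AlgebraicIndependent ℚ ![v i, c * (v j + k)] := by
  classical
  -- the complementary family and the ring it generates
  set x : ({j}ᶜ : Set ι) → ℂ := fun t => v t with hx
  have hxv : Set.range x = v '' ({j}ᶜ : Set ι) := (Set.image_eq_range v _).symm
  have hxind : AlgebraicIndependent ℚ x := hv.comp _ Subtype.val_injective
  set R := Algebra.adjoin ℚ (Set.range x) with hR
  have hkR : k ∈ R := by rw [hR, hxv]; exact hk
  -- `v j` is transcendental over `R`
  have hj : Transcendental R (v j) := by
    have h := hv.transcendental_adjoin (s := ({j}ᶜ : Set ι)) (i := j) (by simp)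
    rw [← hxv] at h
    exact h
  -- hence so is `v j + k`
  have hk' : IsAlgebraic R k := isAlgebraic_algebraMap (⟨k, hkR⟩ : R)
  have h1 : Transcendental R (v j + k) := by
    intro halg
    apply hj
    have h := halg.sub hk'
    simpa using h
  -- and `c * (v j + k)` (`c⁻¹` is algebraic over `ℚ`, hence over `R`)
  have hinj : Function.Injective (algebraMap ℚ R) := (algebraMap ℚ R).injective
  have hcinv : IsAlgebraic R c⁻¹ := (IsAlgebraic.inv_iff.mpr hc).extendScalars hinj
  have h2 : Transcendental R (c * (v j + k)) := by
    intro halg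
    apply h1
    have h := hcinv.mul halg
    rwa [← mul_assoc, inv_mul_cancel₀ hc0, one_mul] at h
  -- glue: the family `Option.elim (c * (v j + k)) x` is independent; extract the pair
  have hopt : AlgebraicIndependent ℚ
      (fun o : Option ({j}ᶜ : Set ι) => o.elim (c * (v j + k)) x) :=
    AlgebraicIndependent.option_iff.mpr ⟨hxind, h2⟩
  have hmem : i ∈ ({j}ᶜ : Set ι) := by simpa using hij
  have h3 := hopt.comp ![some ⟨i, hmem⟩, none] (by
    intro s t hst
    fin_cases s <;> fin_cases t
    · rfl
    · exact absurd hst (by simp)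
    · exact absurd hst (by simp)
    · rfl)
  convert h3 using 1
  funext t; fin_cases t <;> rfl

/-! ### The top rung of the Stokes ladder implies `e ⟂ π` and `e^{i} ⟂ π` -/

/-- `−2i` is algebraic. [bookkeeping] -/
private lemma isAlgebraic_neg_two_mul_I : IsAlgebraic ℚ (-2 * I : ℂ) := by
  have h2 : IsAlgebraic ℚ ((-2 : ℤ) : ℂ) := isAlgebraic_int (-2)
  have h := h2.mul Literature.Barriers.Schanuel.isAlgebraic_I
  simpa using h

/-- From the Stokes identity `iπ/2 = (b − d') − (a − d)`: `π = −2i·(b + (d − d' − a))`. [bookkeeping] -/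
private lemma pi_eq_of_stokes_identity {a b d d' : ℂ}
    (hid : I * (Real.pi : ℂ) / 2 = (b - d') - (a - d)) :
    (Real.pi : ℂ) = (-2 * I) * (b + (d - d' - a)) := by
  have hb : b + (d - d' - a) = I * (Real.pi : ℂ) / 2 := by rw [hid]; ring
  rw [hb]
  have hI : I * I = -1 := Complex.I_mul_I
  linear_combination (Real.pi : ℂ) * hI

/-- **Top rung ⟹ both pairs.** If `a, b, d, d'` satisfy the Stokes identity
`iπ/2 = (b − d') − (a − d)` (as `Ein(1), Ein(i), E₁(1), E₁(i)` do) and the six numbers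
`e, e^{i}, a, b, d, d'` are algebraically independent, then BOTH `(π, e)` and `(π, e^{i})` are
algebraically independent pairs — both alternatives of the Denis dichotomy
`algebraicIndependent_pi_exp_one_or_pi_exp_I`. [this file; FischlerRivoal2024 p. 3] -/
theorem pi_pairs_of_stokesRung {a b d d' : ℂ}
    (hid : I * (Real.pi : ℂ) / 2 = (b - d') - (a - d))
    (h : AlgebraicIndependent ℚ ![cexp 1, cexp I, a, b, d, d']) :
    AlgebraicIndependent ℚ ![(Real.pi : ℂ), cexp 1] ∧
      AlgebraicIndependent ℚ ![(Real.pi : ℂ), cexp I] := by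
  have hk : d - d' - a ∈
      Algebra.adjoin ℚ ((![cexp 1, cexp I, a, b, d, d']) '' ({(3 : Fin 6)}ᶜ : Set (Fin 6))) := by
    refine Subalgebra.sub_mem _ (Subalgebra.sub_mem _ ?_ ?_) ?_
    · exact Algebra.subset_adjoin ⟨4, by simp, rfl⟩
    · exact Algebra.subset_adjoin ⟨5, by simp, rfl⟩
    · exact Algebra.subset_adjoin ⟨2, by simp, rfl⟩
  have hswap : ∀ {u w : ℂ}, AlgebraicIndependent ℚ ![u, w] → AlgebraicIndependent ℚ ![w, u] := by
    intro u w huw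
    have h' := huw.comp ![(1 : Fin 2), 0] (by decide)
    convert h' using 1
    funext t; fin_cases t <;> rfl
  have key0 := algebraicIndependent_pair_affine h (i := 0) (j := 3) (by decide) hk
    isAlgebraic_neg_two_mul_I (by simp [Complex.I_ne_zero])
  have key1 := algebraicIndependent_pair_affine h (i := 1) (j := 3) (by decide) hk
    isAlgebraic_neg_two_mul_I (by simp [Complex.I_ne_zero])
  have hpair0 : AlgebraicIndependent ℚ ![cexp 1, (Real.pi : ℂ)] := by
    rw [pi_eq_of_stokes_identity hid]
    convert key0 using 1
    funext t; fin_cases t <;> rfl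
  have hpair1 : AlgebraicIndependent ℚ ![cexp I, (Real.pi : ℂ)] := by
    rw [pi_eq_of_stokes_identity hid]
    convert key1 using 1
    funext t; fin_cases t <;> rfl
  exact ⟨hswap hpair0, hswap hpair1⟩

/-- **Top rung ⟹ `e ⟂ π`.** Under the Stokes identity and the algebraic independence of
`e, e^{i}, Ein(1), Ein(i), E₁(1), E₁(i)` (abstractly: of `e, e^{i}, a, b, d, d'`), the tree's open
conjecture `ExpOnePiAlgebraicIndependent` holds. The hypothesis is strictly stronger than the
conclusion (it contains the transcendence of `γ = a − d` and of Gompertz's `δ = e·d`); the record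
is where `π` sits: at algebraic arguments, as a Stokes constant between the base points `1` and
`i`. [this file; FischlerRivoal2024 p. 3, Thm 5; Rivoal2012 Cor. 2] -/
theorem expOnePi_of_stokesRung {a b d d' : ℂ}
    (hid : I * (Real.pi : ℂ) / 2 = (b - d') - (a - d))
    (h : AlgebraicIndependent ℚ ![cexp 1, cexp I, a, b, d, d']) :
    ExpOnePiAlgebraicIndependent :=
  expOnePiAlgebraicIndependent_iff_complex.mpr (pi_pairs_of_stokesRung hid h).1

end Summit.Schanuel.Schanuel.Theorems
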